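import Literature.NumberTheory.LFunctions.Zhang2022.Section8ProfileSjMain
import HarnessLib

/-!
# Zhang (2022) §8 for profile data: the SIZE of the gathering's constants in the modulus — every error of the good range,
# the sliver and the engine is `≤ K·𝓛⁻¹` with `K` depending on `c′` and the profile bounds only

Topic `Literature/NumberTheory/LFunctions/Zhang2022` (Landau–Siegel audit tree; verdict-neutral). Y. Zhang, *Discrete mean
estimates and the Landau–Siegel zero*, arXiv:2211.02515v1 (2022) [Zhang2022LandauSiegel] — **an unrefereed manuscript
under adjudication; nothing here asserts or denies its Theorems 1–2; no claim about Landau–Siegel zeros.** Cell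
landau-siegel §D, crux K0 = stmt-Parity-20459 (row (S)), prover ls-knife-K0-p1 g2. Profile-data twin of
`Section8FrontEnd44Reduction.scales`/`final_small` (Zhang's data: range totals `≪ 𝓛⁻¹³, 𝓛^{-9.3}`): with `𝓛 = log D ≥ 3`,
`Λ = 𝓛⁹`, `L₁ = 𝓛^{1.1}` (kept as an atom; `L₁^b ≤ 𝓛^{b+1}` for `b ≤ 10`), `G = 3π(1 + 20|c′|) ≥ ‖β_jΛ‖`, `‖β₆Λ‖ = 3π/2`:

* `Gbound`, `norm_betaJ_mul_le`, `norm_betaMu6_mul_eq`, `norm_A6_le`, `norm_C6_le`, `norm_sigmaJ_le`, `norm_nuJ_le`;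
* `rpow11_pow_le` — `(𝓛^{1.1})^b ≤ 𝓛^{b+1}`;
* `deltaM0_le` (`≤ K_M𝓛⁻⁵`), `deltaN0_le` (`≤ K_N𝓛⁻³`), `errGood_le` (`≤ K_E𝓛⁻¹`), `sliverTotal_le` (`≤ K_S𝓛⁻¹` after `×Λ/π`),
  `engineTotal_le` (`≤ K_eng𝓛⁻³` after `×Λ⁻¹/π`) — the margins of the profile gathering.

## References
* Y. Zhang, arXiv:2211.02515v1 (2022), §8 p. 47 («by simple approximation»), (8.11) p. 48; §2 (2.13), (2.22).
  [cite: Zhang2022LandauSiegel, §8 pp.47–48]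
-/

noncomputable section

open Complex Real MeasureTheory Set
open scoped ComplexConjugate

namespace Literature.NumberTheory.LFunctions.Zhang2022.DipoleRule

open Skeleton KnifeEdge

/-! ### The shift sizes in units of `Λ⁻¹` -/

/-- **`G(c′) = 3π(1 + 20|c′|)`** — a bound for `‖β_jΛ‖`, `j` arbitrary, `D ≥ 3`. [cite: Zhang2022LandauSiegel, §2 (2.13)] -/
def Gbound (c' : ℝ) : ℝ := 3 * π * (1 + 20 * |c'|)

/-- `G ≥ 3π > 0`. [cite: Zhang2022LandauSiegel, §2 (2.13)] -/
theorem Gbound_pos (c' : ℝ) : 0 < Gbound c' := by unfold Gbound; positivity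

/-- `D ≥ 3` once `log D ≥ 3`. [cite: Zhang2022LandauSiegel, §2 (2.1)] -/
theorem three_le_of_log {D : ℕ} (hL : 3 ≤ Real.log D) : 3 ≤ D := by
  by_contra h
  have hD : (D : ℝ) ≤ 2 := by exact_mod_cast (by omega : D ≤ 2)
  have h2 : Real.log D ≤ Real.log 2 := by
    rcases Nat.eq_zero_or_pos D with h0 | h0
    · rw [h0]; simp; exact Real.log_nonneg (by norm_num)
    · exact Real.log_le_log (by exact_mod_cast h0) hD
  have : Real.log 2 < 1 := by
    have := Real.log_two_lt_d9; linarith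
  linarith

/-- **`‖β_jΛ‖ ≤ G`** (`Λ = 𝓛⁹`, `𝓛 ≥ 3`): `‖β_j‖ ≤ 3α(1 + 20|c′|)` and `αΛ = π`. [cite: Zhang2022LandauSiegel, §2 (2.13)] -/
theorem norm_betaJ_mul_le (c' : ℝ) {D : ℕ} (hL : 3 ≤ Real.log D) (j : ℕ) :
    ‖betaJ c' D j * Real.log D ^ 9‖ ≤ Gbound c' := by
  have hD := three_le_of_log hL
  have hℓ0 : 0 < ell D := by rw [ell]; linarith
  have hαΛ := Section8FrontEnd44Sizes.alpha_mul_ell9 hℓ0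
  have hβ := Section8FrontEnd44Sizes.norm_betaJ_le' c' hD j
  have hα0 : 0 ≤ alpha D := by rw [alpha, bigP, Real.log_exp]; exact div_nonneg Real.pi_pos.le (by positivity)
  have h9 : ‖((Real.log D : ℝ) : ℂ) ^ 9‖ = Real.log D ^ 9 := by
    rw [norm_pow, Complex.norm_real, Real.norm_of_nonneg (by linarith)]
  rw [norm_mul, h9]
  calc ‖betaJ c' D j‖ * Real.log D ^ 9 ≤ 3 * alpha D * (1 + 20 * |c'|) * Real.log D ^ 9 := by gcongr
    _ = 3 * (alpha D * ell D ^ 9) * (1 + 20 * |c'|) := by rw [ell]; ring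
    _ = Gbound c' := by rw [hαΛ, Gbound]

/-- **`‖β₆Λ‖ = 3π/2`** (`β₆ = 3iα/2`, `αΛ = π`). [cite: Zhang2022LandauSiegel, §2 (2.22)] -/
theorem norm_betaMu6_mul_eq {D : ℕ} (hℓ : 0 < Real.log D) : ‖betaMu D 6 * Real.log D ^ 9‖ = 3 * π / 2 := by
  have hℓ0 : 0 < ell D := hℓ
  have hαΛ := Section8FrontEnd44Sizes.alpha_mul_ell9 hℓ0
  have hα0 : 0 ≤ alpha D := by rw [alpha, bigP, Real.log_exp]; exact div_nonneg Real.pi_pos.le (by positivity)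
  unfold betaMu beta6
  simp only [show (6 : ℕ) ≠ 7 by decide, if_false]
  have h9 : ‖((Real.log D : ℝ) : ℂ) ^ 9‖ = Real.log D ^ 9 := by
    rw [norm_pow, Complex.norm_real, Real.norm_of_nonneg hℓ.le]
  rw [norm_mul, h9, norm_div, norm_mul, norm_mul, Complex.norm_I, Complex.norm_real, Real.norm_of_nonneg hα0]
  simp only [RCLike.norm_ofNat, mul_one]
  rw [ell] at hαΛ
  calc 3 * alpha D / 2 * Real.log D ^ 9 = 3 * (alpha D * Real.log D ^ 9) / 2 := by ring
    _ = 3 * π / 2 := by rw [hαΛ]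

/-- `‖β_{j+1}β_{j+2}/β₆²‖ ≤ G²/(3π/2)²`. [cite: Zhang2022LandauSiegel, §8 Lemma 8.4] -/
theorem norm_A6_le (c' : ℝ) {D : ℕ} (hL : 3 ≤ Real.log D) (j : ℕ) :
    ‖betaJ c' D (j + 1) * betaJ c' D (j + 2) / betaMu D 6 ^ 2‖ ≤ Gbound c' ^ 2 / (3 * π / 2) ^ 2 := by
  have hℓ : 0 < Real.log D := by linarith
  have hℓC : ((Real.log D : ℝ) : ℂ) ≠ 0 := by exact_mod_cast hℓ.ne'
  have hβ6 : betaMu D 6 ≠ 0 := betaMu_six_ne_zero hℓ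
  have e : betaJ c' D (j + 1) * betaJ c' D (j + 2) / betaMu D 6 ^ 2
      = (betaJ c' D (j + 1) * Real.log D ^ 9) * (betaJ c' D (j + 2) * Real.log D ^ 9)
          / (betaMu D 6 * Real.log D ^ 9) ^ 2 := by
    field_simp
  rw [e, norm_div, norm_mul, norm_pow, norm_betaMu6_mul_eq hℓ]
  have h1 := norm_betaJ_mul_le c' hL (j + 1)
  have h2 := norm_betaJ_mul_le c' hL (j + 2)
  have hG := (Gbound_pos c').le
  rw [div_le_div_iff_of_pos_right (by positivity), sq]
  exact mul_le_mul h1 h2 (norm_nonneg _) hG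

/-- `‖−(β_{j+1}−β₆)(β_{j+2}−β₆)Λ/β₆‖ ≤ (G + 3π/2)²/(3π/2)`. [cite: Zhang2022LandauSiegel, §8 Lemma 8.4] -/
theorem norm_C6_le (c' : ℝ) {D : ℕ} (hL : 3 ≤ Real.log D) (j : ℕ) :
    ‖-((betaJ c' D (j + 1) - betaMu D 6) * (betaJ c' D (j + 2) - betaMu D 6)) * (Real.log D ^ 9 : ℝ) / betaMu D 6‖
      ≤ (Gbound c' + 3 * π / 2) ^ 2 / (3 * π / 2) := by
  have hℓ : 0 < Real.log D := by linarith
  have hℓC : ((Real.log D : ℝ) : ℂ) ≠ 0 := by exact_mod_cast hℓ.ne'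
  have hβ6 : betaMu D 6 ≠ 0 := betaMu_six_ne_zero hℓ
  have e : -((betaJ c' D (j + 1) - betaMu D 6) * (betaJ c' D (j + 2) - betaMu D 6)) * (Real.log D ^ 9 : ℝ) / betaMu D 6
      = -((betaJ c' D (j + 1) * Real.log D ^ 9 - betaMu D 6 * Real.log D ^ 9)
          * (betaJ c' D (j + 2) * Real.log D ^ 9 - betaMu D 6 * Real.log D ^ 9))
          / (betaMu D 6 * Real.log D ^ 9) := by
    push_cast
    field_simp
  rw [e, norm_div, norm_neg, norm_mul, norm_betaMu6_mul_eq hℓ]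
  have h1 : ‖betaJ c' D (j + 1) * Real.log D ^ 9 - betaMu D 6 * Real.log D ^ 9‖ ≤ Gbound c' + 3 * π / 2 := by
    calc _ ≤ ‖betaJ c' D (j + 1) * Real.log D ^ 9‖ + ‖betaMu D 6 * Real.log D ^ 9‖ := norm_sub_le _ _
      _ ≤ Gbound c' + 3 * π / 2 := by rw [norm_betaMu6_mul_eq hℓ]; exact add_le_add (norm_betaJ_mul_le c' hL _) le_rfl
  have h2 : ‖betaJ c' D (j + 2) * Real.log D ^ 9 - betaMu D 6 * Real.log D ^ 9‖ ≤ Gbound c' + 3 * π / 2 := by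
    calc _ ≤ ‖betaJ c' D (j + 2) * Real.log D ^ 9‖ + ‖betaMu D 6 * Real.log D ^ 9‖ := norm_sub_le _ _
      _ ≤ Gbound c' + 3 * π / 2 := by rw [norm_betaMu6_mul_eq hℓ]; exact add_le_add (norm_betaJ_mul_le c' hL _) le_rfl
  have hG := (Gbound_pos c').le
  rw [div_le_div_iff_of_pos_right (by positivity), sq]
  exact mul_le_mul h1 h2 (norm_nonneg _) (by positivity)

/-- `‖σ_j‖ ≤ 2G`. [cite: Zhang2022LandauSiegel, §8 Lemma 8.4] -/
theorem norm_sigmaJ_le (c' : ℝ) {D : ℕ} (hL : 3 ≤ Real.log D) (j : ℕ) : ‖sigmaJ c' D j‖ ≤ 2 * Gbound c' := by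
  unfold sigmaJ
  have e : (betaJ c' D (j + 1) + betaJ c' D (j + 2)) * ((Real.log D ^ 9 : ℝ) : ℂ)
      = betaJ c' D (j + 1) * Real.log D ^ 9 + betaJ c' D (j + 2) * Real.log D ^ 9 := by push_cast; ring
  rw [e]
  calc _ ≤ ‖betaJ c' D (j + 1) * Real.log D ^ 9‖ + ‖betaJ c' D (j + 2) * Real.log D ^ 9‖ := norm_add_le _ _
    _ ≤ Gbound c' + Gbound c' := add_le_add (norm_betaJ_mul_le c' hL _) (norm_betaJ_mul_le c' hL _)
    _ = 2 * Gbound c' := by ring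

/-- `‖ν_j‖ ≤ G²`. [cite: Zhang2022LandauSiegel, §8 Lemma 8.4] -/
theorem norm_nuJ_le (c' : ℝ) {D : ℕ} (hL : 3 ≤ Real.log D) (j : ℕ) : ‖nuJ c' D j‖ ≤ Gbound c' ^ 2 := by
  unfold nuJ
  have e : betaJ c' D (j + 1) * ((Real.log D ^ 9 : ℝ) : ℂ) * (betaJ c' D (j + 2) * ((Real.log D ^ 9 : ℝ) : ℂ))
      = (betaJ c' D (j + 1) * Real.log D ^ 9) * (betaJ c' D (j + 2) * Real.log D ^ 9) := by push_cast; ring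
  rw [e, norm_mul, sq]
  exact mul_le_mul (norm_betaJ_mul_le c' hL _) (norm_betaJ_mul_le c' hL _) (norm_nonneg _) (Gbound_pos c').le

/-! ### `L₁ = 𝓛^{1.1}` against integer powers of `𝓛` -/

/-- **`(𝓛^{1.1})^b ≤ 𝓛^{b+1}` for `b ≤ 10`, `𝓛 ≥ 1`** (`1.1b ≤ b + 1`). [cite: Zhang2022LandauSiegel, §6 p.12] -/
theorem rpow11_pow_le {ℓ : ℝ} (hℓ : 1 ≤ ℓ) {b : ℕ} (hb : b ≤ 10) : (ℓ ^ (11 / 10 : ℝ)) ^ b ≤ ℓ ^ (b + 1) := by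
  have hℓ0 : 0 ≤ ℓ := by linarith
  rw [← Real.rpow_natCast, ← Real.rpow_mul hℓ0, ← Real.rpow_natCast ℓ (b + 1)]
  apply Real.rpow_le_rpow_of_exponent_le hℓ
  have hb' : (b : ℝ) ≤ 10 := by exact_mod_cast hb
  push_cast
  linarith

/-- `1 ≤ 𝓛^{1.1}` and `𝓛 ≤ 𝓛^{1.1}` for `𝓛 ≥ 1`. [cite: Zhang2022LandauSiegel, §6 p.12] -/
theorem rpow11_ge {ℓ : ℝ} (hℓ : 1 ≤ ℓ) : 1 ≤ ℓ ^ (11 / 10 : ℝ) ∧ ℓ ≤ ℓ ^ (11 / 10 : ℝ) := by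
  constructor
  · exact Real.one_le_rpow hℓ (by norm_num)
  · calc ℓ = ℓ ^ (1 : ℝ) := (Real.rpow_one ℓ).symm
      _ ≤ ℓ ^ (11 / 10 : ℝ) := Real.rpow_le_rpow_of_exponent_le hℓ (by norm_num)

/-! ### The margins -/

/-- **`δM₀ ≤ K_M·𝓛⁻⁵`** with `K_M = C₈₂(0)((G+1)²(B₀+B₁+B₂)) + (G+1)²(B₀+B₁+B₂)(2 + 4e^{9/2})`, for `𝓛 ≥ 3`,
`L′ ≤ 4e^{9/2}𝓛²`, `B_i ≥ 0`. [cite: Zhang2022LandauSiegel, §8 Lemma 8.2] -/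
theorem deltaM0_le (c' : ℝ) {D : ℕ} (hL : 3 ≤ Real.log D) (j : ℕ) {B₀ B₁ B₂ L' : ℝ} (hB0 : 0 ≤ B₀) (hB1 : 0 ≤ B₁)
    (hB2 : 0 ≤ B₂) (hL'0 : 0 ≤ L') (hL' : L' ≤ 4 * Real.exp (9 / 2) * Real.log D ^ 2) :
    deltaM0 c' D j B₀ B₁ B₂ L'
      ≤ (Lemma82.C82 0 * ((Gbound c' + 1) ^ 2 * (B₀ + B₁ + B₂))
          + (Gbound c' + 1) ^ 2 * (B₀ + B₁ + B₂) * (2 + 4 * Real.exp (9 / 2))) / Real.log D ^ 5 := by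
  set ℓ := Real.log D with hℓdef
  set L₁ := ℓ ^ (11 / 10 : ℝ) with hL₁
  set G := Gbound c' with hGdef
  have hℓ1 : 1 ≤ ℓ := by linarith
  have hℓ0 : 0 < ℓ := by linarith
  have hG0 : 0 ≤ G := (Gbound_pos c').le
  have hγ : ‖betaJ c' D j * Real.log D ^ 9‖ ≤ G := norm_betaJ_mul_le c' hL j
  set γn := ‖betaJ c' D j * Real.log D ^ 9‖ with hγn
  have hγ0 : 0 ≤ γn := norm_nonneg _
  have hC82 : 0 ≤ Lemma82.C82 0 := by
    unfold Lemma82.C82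
    have : 0 ≤ Lemma82.I0 := Lemma82.I0_nonneg
    positivity
  -- the profile constants against `(G+1)²(B₀+B₁+B₂)`
  set Bs := B₀ + B₁ + B₂ with hBs
  have hBs0 : 0 ≤ Bs := by positivity
  have hJS : (γn * B₀ + B₁) + (γn ^ 2 * B₀ + 2 * γn * B₁ + B₂) ≤ (G + 1) ^ 2 * Bs := by
    rw [hBs]; nlinarith [mul_nonneg hγ0 hB0, mul_nonneg hγ0 hB1, mul_nonneg hG0 hB0, mul_nonneg hG0 hB1,
      mul_nonneg hG0 hB2, mul_nonneg (mul_nonneg hG0 hG0) hB1, mul_nonneg (mul_nonneg hG0 hG0) hB2,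
      mul_nonneg (mul_nonneg hγ0 hB0) (sub_nonneg.mpr hγ), mul_nonneg (mul_nonneg hG0 hB0) (sub_nonneg.mpr hγ)]
  have hS : γn ^ 2 * B₀ + 2 * γn * B₁ + B₂ ≤ (G + 1) ^ 2 * Bs := by
    have : 0 ≤ γn * B₀ + B₁ := by positivity
    linarith
  -- the `L₁` powers
  have hL11 : L₁ ≤ ℓ ^ 2 := by simpa using rpow11_pow_le hℓ1 (b := 1) (by norm_num)
  have hL13 : L₁ ^ 3 ≤ ℓ ^ 4 := rpow11_pow_le hℓ1 (b := 3) (by norm_num)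
  have hL10 : 0 ≤ L₁ := by positivity
  unfold deltaM0
  rw [← hγn, ← hℓdef, ← hL₁]
  -- first piece `≤ C82·(G+1)²Bs/ℓ⁶ ≤ C82(G+1)²Bs/ℓ⁵`
  have h6 : 0 < ℓ ^ 6 := by positivity
  have h9 : 0 < ℓ ^ 9 := by positivity
  have h5 : 0 < ℓ ^ 5 := by positivity
  have p1 : Lemma82.C82 0 / ℓ ^ 6 * ((γn * B₀ + B₁) + (γn ^ 2 * B₀ + 2 * γn * B₁ + B₂))
      ≤ Lemma82.C82 0 * ((G + 1) ^ 2 * Bs) / ℓ ^ 5 := by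
    rw [div_mul_eq_mul_div, div_le_div_iff₀ h6 h5]
    have : Lemma82.C82 0 * ((γn * B₀ + B₁) + (γn ^ 2 * B₀ + 2 * γn * B₁ + B₂)) ≤ Lemma82.C82 0 * ((G + 1) ^ 2 * Bs) :=
      mul_le_mul_of_nonneg_left hJS hC82
    have hℓ56 : ℓ ^ 5 ≤ ℓ ^ 6 := pow_le_pow_right₀ hℓ1 (by norm_num)
    calc _ ≤ Lemma82.C82 0 * ((G + 1) ^ 2 * Bs) * ℓ ^ 5 := mul_le_mul_of_nonneg_right this h5.le
      _ ≤ Lemma82.C82 0 * ((G + 1) ^ 2 * Bs) * ℓ ^ 6 :=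
          mul_le_mul_of_nonneg_left hℓ56 (mul_nonneg hC82 (by positivity))
  -- second piece `(L₁/ℓ⁹)·S·(2L₁² + L') ≤ S(2ℓ⁴ + 4e^{9/2}ℓ⁴)/ℓ⁹ = S(2+4e^{9/2})/ℓ⁵`
  have p2 : L₁ / ℓ ^ 9 * (γn ^ 2 * B₀ + 2 * γn * B₁ + B₂) * (2 * L₁ ^ 2 + L')
      ≤ (G + 1) ^ 2 * Bs * (2 + 4 * Real.exp (9 / 2)) / ℓ ^ 5 := by
    have hin : L₁ * (2 * L₁ ^ 2 + L') ≤ (2 + 4 * Real.exp (9 / 2)) * ℓ ^ 4 := by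
      have e1 : L₁ * (2 * L₁ ^ 2 + L') = 2 * L₁ ^ 3 + L₁ * L' := by ring
      rw [e1]
      have : L₁ * L' ≤ ℓ ^ 2 * (4 * Real.exp (9 / 2) * ℓ ^ 2) := mul_le_mul hL11 hL' hL'0 (by positivity)
      nlinarith
    have hS0 : 0 ≤ γn ^ 2 * B₀ + 2 * γn * B₁ + B₂ := by positivity
    calc L₁ / ℓ ^ 9 * (γn ^ 2 * B₀ + 2 * γn * B₁ + B₂) * (2 * L₁ ^ 2 + L')
        = (γn ^ 2 * B₀ + 2 * γn * B₁ + B₂) * (L₁ * (2 * L₁ ^ 2 + L')) / ℓ ^ 9 := by ring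
      _ ≤ ((G + 1) ^ 2 * Bs) * ((2 + 4 * Real.exp (9 / 2)) * ℓ ^ 4) / ℓ ^ 9 := by
          gcongr
      _ = (G + 1) ^ 2 * Bs * (2 + 4 * Real.exp (9 / 2)) / ℓ ^ 5 := by
          field_simp
  rw [add_div]
  exact add_le_add p1 p2

/-- The second piece of `δN₀` as a pure real inequality: with `τ₁ = 2L₁/ℓ⁹`, `1 ≤ L₁ ≤ ℓ²`, `L₁⁵ ≤ ℓ⁶`, `τ₁ ≤ 1`,
`0 ≤ S ≤ (3π/2+1)²Bs`, `L′ ≤ 4e^{9/2}ℓ²`, `X ≤ 1 + A`: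
`τ₁S(τ₁ℓ⁹Ξ₀(1+2L₁)³ + L′(A + X + Cτ₁)) ≤ 2(3π/2+1)²Bs(108Ξ₀ + 4e^{9/2}(1+2A+2C))/ℓ³`. [cite: Zhang2022LandauSiegel, §8 p.47] -/
theorem deltaN0_piece2_le {ℓ L₁ S Bs Ξ₀ L' A X C τ₁ : ℝ} (hℓ1 : 1 ≤ ℓ) (hL1ge : 1 ≤ L₁) (hL11 : L₁ ≤ ℓ ^ 2)
    (hL15 : L₁ ^ 5 ≤ ℓ ^ 6) (hτ₁ : τ₁ = 2 * L₁ / ℓ ^ 9) (hτ1 : τ₁ ≤ 1) (hS0 : 0 ≤ S)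
    (hSle : S ≤ (3 * π / 2 + 1) ^ 2 * Bs) (hBs0 : 0 ≤ Bs) (hΞ0 : 0 ≤ Ξ₀) (hL'0 : 0 ≤ L')
    (hL' : L' ≤ 4 * Real.exp (9 / 2) * ℓ ^ 2) (hA0 : 0 ≤ A) (hC0 : 0 ≤ C) (hX : X ≤ 1 + A) :
    τ₁ * S * (τ₁ * ℓ ^ 9 * (Ξ₀ * (1 + 2 * L₁) ^ 3) + L' * (A + X + C * τ₁))
      ≤ 2 * ((3 * π / 2 + 1) ^ 2 * Bs) * (108 * Ξ₀ + 4 * Real.exp (9 / 2) * (1 + 2 * A + 2 * C)) / ℓ ^ 3 := by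
  have hℓ0 : 0 < ℓ := by linarith
  have h9 : 0 < ℓ ^ 9 := by positivity
  have h3 : 0 < ℓ ^ 3 := by positivity
  have hL10 : 0 ≤ L₁ := by linarith
  have hτ0 : 0 ≤ τ₁ := by rw [hτ₁]; positivity
  have hΞ : τ₁ * ℓ ^ 9 * (Ξ₀ * (1 + 2 * L₁) ^ 3) ≤ 54 * Ξ₀ * L₁ ^ 4 := by
    have e : τ₁ * ℓ ^ 9 = 2 * L₁ := by rw [hτ₁, div_mul_cancel₀ _ h9.ne']
    rw [e]
    have h12 : (1 + 2 * L₁) ^ 3 ≤ 27 * L₁ ^ 3 := by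
      have h3L : 1 + 2 * L₁ ≤ 3 * L₁ := by linarith
      calc (1 + 2 * L₁) ^ 3 ≤ (3 * L₁) ^ 3 := pow_le_pow_left₀ (by positivity) h3L 3
        _ = 27 * L₁ ^ 3 := by ring
    calc 2 * L₁ * (Ξ₀ * (1 + 2 * L₁) ^ 3) ≤ 2 * L₁ * (Ξ₀ * (27 * L₁ ^ 3)) := by gcongr
      _ = 54 * Ξ₀ * L₁ ^ 4 := by ring
  have hAC : 0 ≤ 1 + 2 * A + 2 * C := by positivity
  have hLpart : L' * (A + X + C * τ₁) ≤ 4 * Real.exp (9 / 2) * ℓ ^ 2 * (1 + 2 * A + 2 * C) := by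
    have hCτ : C * τ₁ ≤ C := mul_le_of_le_one_right hC0 hτ1
    have : A + X + C * τ₁ ≤ 1 + 2 * A + 2 * C := by linarith
    calc L' * (A + X + C * τ₁) ≤ L' * (1 + 2 * A + 2 * C) :=
          mul_le_mul_of_nonneg_left this hL'0
      _ ≤ (4 * Real.exp (9 / 2) * ℓ ^ 2) * (1 + 2 * A + 2 * C) := mul_le_mul_of_nonneg_right hL' hAC
      _ = _ := by ring
  have hinner : τ₁ * ℓ ^ 9 * (Ξ₀ * (1 + 2 * L₁) ^ 3) + L' * (A + X + C * τ₁)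
      ≤ 54 * Ξ₀ * L₁ ^ 4 + 4 * Real.exp (9 / 2) * ℓ ^ 2 * (1 + 2 * A + 2 * C) := add_le_add hΞ hLpart
  have hstep : τ₁ * S * (54 * Ξ₀ * L₁ ^ 4 + 4 * Real.exp (9 / 2) * ℓ ^ 2 * (1 + 2 * A + 2 * C))
      = S * (108 * Ξ₀ * L₁ ^ 5 + 8 * Real.exp (9 / 2) * (L₁ * ℓ ^ 2) * (1 + 2 * A + 2 * C)) / ℓ ^ 9 := by
    rw [hτ₁]; ring
  have hL1l2 : L₁ * ℓ ^ 2 ≤ ℓ ^ 6 := by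
    have h1 : L₁ * ℓ ^ 2 ≤ ℓ ^ 2 * ℓ ^ 2 := mul_le_mul_of_nonneg_right hL11 (by positivity)
    have h2 : ℓ ^ 2 * ℓ ^ 2 = ℓ ^ 4 := by ring
    have hℓ46 : ℓ ^ 4 ≤ ℓ ^ 6 := pow_le_pow_right₀ hℓ1 (by norm_num)
    linarith
  have hnum : 108 * Ξ₀ * L₁ ^ 5 + 8 * Real.exp (9 / 2) * (L₁ * ℓ ^ 2) * (1 + 2 * A + 2 * C)
      ≤ (108 * Ξ₀ + 4 * Real.exp (9 / 2) * (1 + 2 * A + 2 * C)) * (2 * ℓ ^ 6) := by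
    have a1 : 108 * Ξ₀ * L₁ ^ 5 ≤ 108 * Ξ₀ * ℓ ^ 6 := mul_le_mul_of_nonneg_left hL15 (by positivity)
    have a2 : 8 * Real.exp (9 / 2) * (L₁ * ℓ ^ 2) * (1 + 2 * A + 2 * C)
        ≤ 8 * Real.exp (9 / 2) * ℓ ^ 6 * (1 + 2 * A + 2 * C) :=
      mul_le_mul_of_nonneg_right (mul_le_mul_of_nonneg_left hL1l2 (by positivity)) hAC
    have a3 : 0 ≤ 108 * Ξ₀ * ℓ ^ 6 := by positivity
    have e3 : (108 * Ξ₀ + 4 * Real.exp (9 / 2) * (1 + 2 * A + 2 * C)) * (2 * ℓ ^ 6)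
        = (108 * Ξ₀ * ℓ ^ 6 + 8 * Real.exp (9 / 2) * ℓ ^ 6 * (1 + 2 * A + 2 * C)) + 108 * Ξ₀ * ℓ ^ 6 := by ring
    rw [e3]
    linarith [add_le_add a1 a2]
  calc τ₁ * S * _ ≤ τ₁ * S * (54 * Ξ₀ * L₁ ^ 4 + 4 * Real.exp (9 / 2) * ℓ ^ 2 * (1 + 2 * A + 2 * C)) :=
        mul_le_mul_of_nonneg_left hinner (mul_nonneg hτ0 hS0)
    _ = S * (108 * Ξ₀ * L₁ ^ 5 + 8 * Real.exp (9 / 2) * (L₁ * ℓ ^ 2) * (1 + 2 * A + 2 * C)) / ℓ ^ 9 := hstep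
    _ ≤ ((3 * π / 2 + 1) ^ 2 * Bs) * ((108 * Ξ₀ + 4 * Real.exp (9 / 2) * (1 + 2 * A + 2 * C)) * (2 * ℓ ^ 6))
          / ℓ ^ 9 := by
        gcongr
    _ = 2 * ((3 * π / 2 + 1) ^ 2 * Bs) * (108 * Ξ₀ + 4 * Real.exp (9 / 2) * (1 + 2 * A + 2 * C)) / ℓ ^ 3 := by
        rw [div_eq_div_iff h9.ne' h3.ne']; ring

/-- **`δN₀ ≤ K_N·𝓛⁻³`**, `K_N = C₈₄(1 + (3π/2+1)²)(B₀+B₁+B₂) + 2(3π/2+1)²(B₀+B₁+B₂)(108Ξ₀ + 4e^{9/2}(1 + 2A + 2C))`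
where `A = G²/(3π/2)²`, `C = (G+3π/2)²/(3π/2)`, for `𝓛 ≥ 3`, `L′ ≤ 4e^{9/2}𝓛²`, `Ξ = Ξ₀(1 + 2L₁)³`, `Ξ₀, C₈₄, B_i ≥ 0`.
[cite: Zhang2022LandauSiegel, §8 Lemma 8.4, p.47] -/
theorem deltaN0_le (c' : ℝ) {D : ℕ} (hL : 3 ≤ Real.log D) (j : ℕ) {B₀ B₁ B₂ C₈₄ Ξ₀ L' : ℝ} (hB0 : 0 ≤ B₀)
    (hB1 : 0 ≤ B₁) (hB2 : 0 ≤ B₂) (hC84 : 0 ≤ C₈₄) (hΞ0 : 0 ≤ Ξ₀) (hL'0 : 0 ≤ L')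
    (hL' : L' ≤ 4 * Real.exp (9 / 2) * Real.log D ^ 2) :
    deltaN0 c' D j B₀ B₁ B₂ C₈₄ (Ξ₀ * (1 + 2 * Real.log D ^ (11 / 10 : ℝ)) ^ 3) L'
      ≤ (C₈₄ * ((1 + (3 * π / 2 + 1) ^ 2) * (B₀ + B₁ + B₂))
          + 2 * ((3 * π / 2 + 1) ^ 2 * (B₀ + B₁ + B₂))
            * (108 * Ξ₀ + 4 * Real.exp (9 / 2) *
                (1 + 2 * (Gbound c' ^ 2 / (3 * π / 2) ^ 2) + 2 * ((Gbound c' + 3 * π / 2) ^ 2 / (3 * π / 2)))))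
        / Real.log D ^ 3 := by
  have hℓ1 : 1 ≤ Real.log D := by linarith
  have hℓ0 : 0 < Real.log D := by linarith
  have h6 : ‖betaMu D 6 * Real.log D ^ 9‖ = 3 * π / 2 := norm_betaMu6_mul_eq hℓ0
  have hA6 := norm_A6_le c' hL j
  have hC6 := norm_C6_le c' hL j
  have h1A : ‖1 - betaJ c' D (j + 1) * betaJ c' D (j + 2) / betaMu D 6 ^ 2‖ ≤ 1 + Gbound c' ^ 2 / (3 * π / 2) ^ 2 := by
    calc _ ≤ ‖(1 : ℂ)‖ + ‖betaJ c' D (j + 1) * betaJ c' D (j + 2) / betaMu D 6 ^ 2‖ := norm_sub_le _ _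
      _ ≤ _ := by rw [norm_one]; exact add_le_add le_rfl hA6
  obtain ⟨hL1ge, -⟩ := rpow11_ge hℓ1
  have hL15 : (Real.log D ^ (11 / 10 : ℝ)) ^ 5 ≤ Real.log D ^ 6 := rpow11_pow_le hℓ1 (b := 5) (by norm_num)
  have hL11 : Real.log D ^ (11 / 10 : ℝ) ≤ Real.log D ^ 2 := by simpa using rpow11_pow_le hℓ1 (b := 1) (by norm_num)
  have hS0 : 0 ≤ B₂ + 2 * (3 * π / 2) * B₁ + (3 * π / 2) ^ 2 * B₀ := by positivity
  have hSle : B₂ + 2 * (3 * π / 2) * B₁ + (3 * π / 2) ^ 2 * B₀ ≤ (3 * π / 2 + 1) ^ 2 * (B₀ + B₁ + B₂) := by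
    nlinarith [Real.pi_pos, mul_nonneg Real.pi_pos.le hB0, mul_nonneg Real.pi_pos.le hB1,
      mul_nonneg Real.pi_pos.le hB2, mul_nonneg (mul_nonneg Real.pi_pos.le Real.pi_pos.le) hB1,
      mul_nonneg (mul_nonneg Real.pi_pos.le Real.pi_pos.le) hB2]
  have hBs0 : 0 ≤ B₀ + B₁ + B₂ := by positivity
  -- `τ₁ ≤ 1`
  have h9 : 0 < Real.log D ^ 9 := by positivity
  have hτ1 : 2 * Real.log D ^ (11 / 10 : ℝ) / Real.log D ^ 9 ≤ 1 := by
    rw [div_le_one h9]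
    have h7 : (2 : ℝ) ≤ Real.log D ^ 7 := by
      calc (2 : ℝ) ≤ 3 ^ 7 := by norm_num
        _ ≤ Real.log D ^ 7 := pow_le_pow_left₀ (by norm_num) hL 7
    calc 2 * Real.log D ^ (11 / 10 : ℝ) ≤ Real.log D ^ 7 * Real.log D ^ 2 :=
          mul_le_mul h7 hL11 (by positivity) (by positivity)
      _ = Real.log D ^ 9 := by ring
  -- piece 1
  have h3 : 0 < Real.log D ^ 3 := by positivity
  have p1 : C₈₄ / Real.log D ^ 6 * (B₁ + (B₂ + 2 * (3 * π / 2) * B₁ + (3 * π / 2) ^ 2 * B₀))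
      ≤ C₈₄ * ((1 + (3 * π / 2 + 1) ^ 2) * (B₀ + B₁ + B₂)) / Real.log D ^ 3 := by
    have hB1S : B₁ + (B₂ + 2 * (3 * π / 2) * B₁ + (3 * π / 2) ^ 2 * B₀) ≤ (1 + (3 * π / 2 + 1) ^ 2) * (B₀ + B₁ + B₂) := by
      have : B₁ ≤ B₀ + B₁ + B₂ := by linarith
      linarith
    rw [div_mul_eq_mul_div, div_le_div_iff₀ (by positivity) h3]
    have hℓ36 : Real.log D ^ 3 ≤ Real.log D ^ 6 := pow_le_pow_right₀ hℓ1 (by norm_num)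
    calc C₈₄ * (B₁ + (B₂ + 2 * (3 * π / 2) * B₁ + (3 * π / 2) ^ 2 * B₀)) * Real.log D ^ 3
        ≤ C₈₄ * ((1 + (3 * π / 2 + 1) ^ 2) * (B₀ + B₁ + B₂)) * Real.log D ^ 3 := by gcongr
      _ ≤ C₈₄ * ((1 + (3 * π / 2 + 1) ^ 2) * (B₀ + B₁ + B₂)) * Real.log D ^ 6 :=
          mul_le_mul_of_nonneg_left hℓ36 (mul_nonneg hC84 (mul_nonneg (by positivity) hBs0))
  have p2 := deltaN0_piece2_le (Bs := B₀ + B₁ + B₂) (Ξ₀ := Ξ₀) (A := Gbound c' ^ 2 / (3 * π / 2) ^ 2)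
    (C := (Gbound c' + 3 * π / 2) ^ 2 / (3 * π / 2)) (X := ‖1 - betaJ c' D (j + 1) * betaJ c' D (j + 2) / betaMu D 6 ^ 2‖)
    hℓ1 hL1ge hL11 hL15 rfl hτ1 hS0 hSle hBs0 hΞ0 hL'0 hL' (by positivity) (by positivity) h1A
  unfold deltaN0
  rw [h6, add_div]
  refine add_le_add p1 (le_trans ?_ p2)
  -- monotonicity in `‖A₆‖ ≤ A`, `‖C₆‖ ≤ C` inside the second piece
  have hτ0 : 0 ≤ 2 * Real.log D ^ (11 / 10 : ℝ) / Real.log D ^ 9 := by positivity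
  apply mul_le_mul_of_nonneg_left _ (mul_nonneg hτ0 hS0)
  apply add_le_add le_rfl
  apply mul_le_mul_of_nonneg_left _ hL'0
  gcongr

/-- **`ERR ≤ K_E·𝓛⁻¹`:** with `δM₀ ≤ K_M𝓛⁻⁵`, `δN₀ ≤ K_N𝓛⁻³`, `L′ ≤ 4e^{9/2}𝓛²`, `K₀ ≤ K`, `J₀ ≤ J` (`𝓛 ≥ 1`, everything
nonnegative): `δM₀(L′K₀ + δN₀) + L′J₀δN₀ ≤ (K_M(4e^{9/2}K + K_N) + 4e^{9/2}J·K_N)/𝓛` — pure real bookkeeping.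
[cite: Zhang2022LandauSiegel, §8 p.47] -/
theorem errGood_le_of {ℓ dM dN L' K J KM KN : ℝ} (hℓ1 : 1 ≤ ℓ) (hdM0 : 0 ≤ dM) (hdM : dM ≤ KM / ℓ ^ 5)
    (hdN0 : 0 ≤ dN) (hdN : dN ≤ KN / ℓ ^ 3) (hL'0 : 0 ≤ L') (hL' : L' ≤ 4 * Real.exp (9 / 2) * ℓ ^ 2)
    (hK0 : 0 ≤ K) (hJ0 : 0 ≤ J) :
    dM * (L' * K + dN) + L' * J * dN ≤ (KM * (4 * Real.exp (9 / 2) * K + KN) + 4 * Real.exp (9 / 2) * J * KN) / ℓ := by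
  have hℓ0 : 0 < ℓ := by linarith
  have hKM0 : 0 ≤ KM := by
    have h5 : 0 < ℓ ^ 5 := by positivity
    have h := (le_div_iff₀ h5).mp (hdM0.trans hdM)
    simpa using h
  have hKN0 : 0 ≤ KN := by
    have h3 : 0 < ℓ ^ 3 := by positivity
    have h := (le_div_iff₀ h3).mp (hdN0.trans hdN)
    simpa using h
  -- each term against `1/ℓ`
  have hinv : ∀ n : ℕ, 1 ≤ n → 1 / ℓ ^ n ≤ 1 / ℓ := fun n hn => by
    rw [div_le_div_iff₀ (by positivity) hℓ0, one_mul, one_mul]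
    calc ℓ = ℓ ^ 1 := (pow_one ℓ).symm
      _ ≤ ℓ ^ n := pow_le_pow_right₀ hℓ1 hn
  have t1 : dM * (L' * K) ≤ KM * (4 * Real.exp (9 / 2) * K) / ℓ := by
    calc dM * (L' * K) ≤ KM / ℓ ^ 5 * (4 * Real.exp (9 / 2) * ℓ ^ 2 * K) := by gcongr
      _ = KM * (4 * Real.exp (9 / 2) * K) * (1 / ℓ ^ 3) := by field_simp
      _ ≤ KM * (4 * Real.exp (9 / 2) * K) * (1 / ℓ) :=
          mul_le_mul_of_nonneg_left (hinv 3 (by norm_num)) (by positivity)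
      _ = KM * (4 * Real.exp (9 / 2) * K) / ℓ := by ring
  have t2 : dM * dN ≤ KM * KN / ℓ := by
    calc dM * dN ≤ KM / ℓ ^ 5 * (KN / ℓ ^ 3) := mul_le_mul hdM hdN hdN0 (by positivity)
      _ = KM * KN * (1 / ℓ ^ 8) := by field_simp
      _ ≤ KM * KN * (1 / ℓ) := mul_le_mul_of_nonneg_left (hinv 8 (by norm_num)) (by positivity)
      _ = KM * KN / ℓ := by ring
  have t3 : L' * J * dN ≤ 4 * Real.exp (9 / 2) * J * KN / ℓ := by
    calc L' * J * dN ≤ 4 * Real.exp (9 / 2) * ℓ ^ 2 * J * (KN / ℓ ^ 3) := by gcongr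
      _ = 4 * Real.exp (9 / 2) * J * KN * (1 / ℓ) := by field_simp
      _ = 4 * Real.exp (9 / 2) * J * KN / ℓ := by ring
  have e : dM * (L' * K + dN) + L' * J * dN = dM * (L' * K) + dM * dN + L' * J * dN := by ring
  rw [e]
  have e2 : (KM * (4 * Real.exp (9 / 2) * K + KN) + 4 * Real.exp (9 / 2) * J * KN) / ℓ
      = KM * (4 * Real.exp (9 / 2) * K) / ℓ + KM * KN / ℓ + 4 * Real.exp (9 / 2) * J * KN / ℓ := by
    field_simp
  rw [e2]
  exact add_le_add (add_le_add t1 t2) t3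

/-- **Sliver total `≤ K_S·𝓛⁻¹` after `×Λ/π`:** with `τ₁ = 2L₁/Λ`, `Ξ = Ξ₀(1+2L₁)³`, `log(e^{θΛ}/Y) = 2L₁` the sliver bound
`(Λ/π)·2e⁴³⁰·B₁²τ₁²(1+τ₁Λ)Ξ·(1 + 2L₁)` is `≤ (8·3⁵e⁴³⁰/π)B₁²Ξ₀·𝓛⁻¹` (`L₁⁷ ≤ 𝓛⁸`). [cite: Zhang2022LandauSiegel, §8 p.47] -/
theorem sliverTotal_le {ℓ B₁ Ξ₀ : ℝ} (hℓ : 3 ≤ ℓ) (hΞ0 : 0 ≤ Ξ₀) :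
    ℓ ^ 9 / π * (2 * Real.exp 430 *
        (B₁ ^ 2 * (2 * ℓ ^ (11 / 10 : ℝ) / ℓ ^ 9) ^ 2 * (1 + 2 * ℓ ^ (11 / 10 : ℝ) / ℓ ^ 9 * ℓ ^ 9)
          * (Ξ₀ * (1 + 2 * ℓ ^ (11 / 10 : ℝ)) ^ 3))
        * (1 + 2 * ℓ ^ (11 / 10 : ℝ)))
      ≤ 8 * 3 ^ 5 * Real.exp 430 / π * B₁ ^ 2 * Ξ₀ / ℓ := by
  have hℓ1 : 1 ≤ ℓ := by linarith
  have hℓ0 : 0 < ℓ := by linarith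
  obtain ⟨hL1ge, -⟩ := rpow11_ge hℓ1
  set L₁ := ℓ ^ (11 / 10 : ℝ) with hL₁
  have hL17 : L₁ ^ 7 ≤ ℓ ^ 8 := rpow11_pow_le hℓ1 (b := 7) (by norm_num)
  clear_value L₁
  have h9 : 0 < ℓ ^ 9 := by positivity
  have e1 : 2 * L₁ / ℓ ^ 9 * ℓ ^ 9 = 2 * L₁ := div_mul_cancel₀ _ h9.ne'
  rw [e1]
  have h12 : (1 + 2 * L₁) ≤ 3 * L₁ := by linarith
  have hL0 : 0 ≤ L₁ := by linarith
  -- collect: LHS = (8e⁴³⁰/π)·B₁²Ξ₀·L₁²(1+2L₁)⁵/ℓ⁹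
  have e2 : ℓ ^ 9 / π * (2 * Real.exp 430 *
        (B₁ ^ 2 * (2 * L₁ / ℓ ^ 9) ^ 2 * (1 + 2 * L₁) * (Ξ₀ * (1 + 2 * L₁) ^ 3)) * (1 + 2 * L₁))
      = 8 * Real.exp 430 / π * B₁ ^ 2 * Ξ₀ * (L₁ ^ 2 * (1 + 2 * L₁) ^ 5) / ℓ ^ 9 := by
    field_simp
    ring
  rw [e2]
  have hpow : L₁ ^ 2 * (1 + 2 * L₁) ^ 5 ≤ 3 ^ 5 * ℓ ^ 8 := by
    calc L₁ ^ 2 * (1 + 2 * L₁) ^ 5 ≤ L₁ ^ 2 * (3 * L₁) ^ 5 := by gcongr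
      _ = 3 ^ 5 * L₁ ^ 7 := by ring
      _ ≤ 3 ^ 5 * ℓ ^ 8 := by gcongr
  have hc : 0 ≤ 8 * Real.exp 430 / π * B₁ ^ 2 * Ξ₀ := by positivity
  calc 8 * Real.exp 430 / π * B₁ ^ 2 * Ξ₀ * (L₁ ^ 2 * (1 + 2 * L₁) ^ 5) / ℓ ^ 9
      ≤ 8 * Real.exp 430 / π * B₁ ^ 2 * Ξ₀ * (3 ^ 5 * ℓ ^ 8) / ℓ ^ 9 := by gcongr
    _ = 8 * 3 ^ 5 * Real.exp 430 / π * B₁ ^ 2 * Ξ₀ / ℓ := by field_simp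

/-- **Engine total `≤ K_eng·𝓛⁻³` after `×Λ⁻¹/π`:** `(Λ/π)·Λ⁻²·C𝓛⁶(M + (M₁/Λ)𝓛⁹) = (C/π)(M + M₁)/𝓛³` (`Λ = 𝓛⁹`).
[cite: Zhang2022LandauSiegel, §8 (8.11) p.48] -/
theorem engineTotal_eq {ℓ C M M₁ : ℝ} (hℓ : 0 < ℓ) :
    ℓ ^ 9 / π * ((ℓ ^ 9 * ℓ ^ 9)⁻¹ * (C * ℓ ^ 6 * (M + M₁ / ℓ ^ 9 * ℓ ^ 9))) = C / π * (M + M₁) / ℓ ^ 3 := by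
  have h9 : ℓ ^ 9 ≠ 0 := by positivity
  field_simp

end Literature.NumberTheory.LFunctions.Zhang2022.DipoleRule

end
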